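/-
Copyright (c) 2026 the pub-hodgecm-mathlib formalisation cell (harness21).  Prover seat hodgecm-mathlib-LH4-p14 (g6), 2026-09-04 — STAGE-1b (β-BAL) road: brick (β-BAL-3) = B3,
FILE 5 — the quaternion datum of FILE 4 EXISTS (from B3's own regimes (B)∕(C) at `j = 1`), so the anisotropic conic count vanishes with NO extra datum.
-/
import Summits.HodgeConjecture.HodgeConjecture.Theorems.F0P3cDyRamBinaryNormFormCharCount           -- ★ p860500 FILE 2 (this seat): (B) zero regime, (C) conductor regime; brings FILE 1 + the ★ ω-toolkit
import Summits.HodgeConjecture.HodgeConjecture.Theorems.F0P3cDyRamBinaryNormFormConicAnisotropic     -- ★ p860828 FILE 4 (this seat): the Möbius involution, (D-aniso) modulo the datum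
import Summits.HodgeConjecture.HodgeConjecture.Theorems.F0P3cDyRamDiagonalGluedClassRepresentatives -- ★ (κG lineage): `exists_fixed_class_representatives` (fixed unit classes mod `𝔭^ρ`)
import Summits.HodgeConjecture.HodgeConjecture.Theorems.F0P3cDyRamDiagonalFixedClassSystems        -- ★ (κG lineage): `exists_repr_fixedBall_card` (fixed integral classes mod `𝔭^ρ`)
import Literature.NumberTheory.LocalFields.WildQuadraticDatumNormOneQuotient                    -- ★ `two_le_of_v_two_lt_one`
import HarnessLib

/-!
# Crux `H413`, line LH4 «(D-RAM) FOUR-FRAME», STAGE-1b (β-BAL) — B3 FILE 5: THE MÖBIUS DATUM EXISTS; the anisotropic conic count vanishes UNCONDITIONALLY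

Cell `hodgecm-mathlib` (D-0151), FLOOR 0, crux item H413 = `stmt-HodgeConjecture-24833`, route `HCCMUnconditional`; squad LH4; lane `--supports stmt-HodgeConjecture-24833 --as helper`.
THEOREMS ONLY (no `def`, no instance, no `sorry`); pure local arithmetic; COUNT-NEUTRAL.

★ FILE 4 kills the anisotropic `j = 0` count given a quaternion datum `(a, b)` with `|a| = 1`, `|b| ≤ |ϖ|`, `N a − c·N b ∉ N`.  Such a datum exists for EVERY fixed unit `c`: take `a = 1`,
`b = ϖ·r`; then `N a − c N b = 1 + (−c)·ϖ_F·N r` (`ϖ_F = ϖσϖ`) and B3's own regimes at `j = 1` — (B) «zero» for `d ≥ 3` (`Σ_r ω(1 − cϖ_F N r) = 0` over the unit residues) and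
(C) «across the conductor» for `d = 2` (`(q−1)·Σ = −ω(1)·#R^× < 0`) — force SOME unit residue `r` with `ω(1 − cϖ_F N r) = −1`.  The F-side representative systems those regimes want
exist by ★ `exists_fixed_class_representatives` ∕ ★ `exists_repr_fixedBall_card` (κG lineage).  Hence:
* §1 `exists_mobius_datum` — for a residue system `R` mod `ϖ^s` with a unit class and `2(d−1) ≤ s`: `∃ a b, |a| = 1 ∧ |b| ≤ |ϖ| ∧ ¬∃ z, zσz = a σa − c·(b σb)`.
* §2 `sum_units_normSign_binaryNormForm_zero_eq_zero_of_anisotropic'` — ★ FILE 4 with the datum DISCHARGED: `c = −C₀∕C₁ ∉ N`, `4d ≤ s + 3` ⇒ `Σ_{r ∈ R, |r|=1} ω(C₀ + C₁N r) = 0`.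
HONEST LABEL.  Count-neutral; (β-BAL), (β), T₊ stay OPEN; HC_CM is proved only modulo the 7 printed citations (2 remaining named inputs: hLiu418 = `stmt-HodgeConjecture-24832`,
h413 = `stmt-HodgeConjecture-24833`) until rung 0 closes.

## References
* [Serre1979] J.-P. Serre, *Local Fields*, GTM 67 (1979) — Ch. V §3 Cor. 3, Ch. XIII §5, Ch. XV §2.
* [NeukirchANT1999] J. Neukirch, *Algebraic Number Theory* (1999) — Ch. V (1.3).
-/

set_option autoImplicit false

noncomputable section

namespace Summit.HodgeConjecture.HodgeConjecture.Cruxes.H413.F0P3cDyRamBinaryNormFormConicOfRecord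

open WithZero
open scoped Valued
open Literature.NumberTheory.Automorphic.UnitaryThreeFourFrame
open Literature.NumberTheory.LocalFields.WildQuadraticDatum
open Summit.HodgeConjecture.HodgeConjecture.Cruxes.H413.F0P3cDyRamBinaryNormFormFixedSums
open Summit.HodgeConjecture.HodgeConjecture.Cruxes.H413.F0P3cDyRamBinaryNormFormCharCount
open Summit.HodgeConjecture.HodgeConjecture.Cruxes.H413.F0P3cDyRamBinaryNormFormConicAnisotropic
open Summit.HodgeConjecture.HodgeConjecture.Cruxes.H413.F0P3cDyRamDiagonalGluedClassRepresentatives (exists_fixed_class_representatives)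
open Summit.HodgeConjecture.HodgeConjecture.Cruxes.H413.F0P3cDyRamDiagonalFixedClassSystems (exists_repr_fixedBall_card)

variable {K : Type} [Field K] [Valued K ℤᵐ⁰] {σ : K →+* K} {ϖ : K} {d t : ℕ}

/-! ## §1  The Möbius datum exists -/

/-- **THE MÖBIUS DATUM EXISTS.**  Ramified datum on a complete `K` with finite residue field, `|2| < 1`; `c` a fixed unit; `R` a complete irredundant residue system of `𝒪_K` modulo
`ϖ^s` with `2(d − 1) ≤ s` and at least one unit class.  Then there are `a, b` with `|a| = 1`, `|b| ≤ |ϖ|` and `N a − c·N b` NOT a norm — namely `a = 1`, `b = ϖ·r` for a unit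
residue `r` with `ω(1 − c·ϖ_F·N r) = −1`, which B3's regime (B) (`d ≥ 3`, the signed sum is `0`) resp. (C) (`d = 2`, `(q−1)·Σ = −#R^×`) provides.
[cite: Serre1979, Ch. V §3 Cor. 3; Ch. XIII §5] [cite: NeukirchANT1999, Ch. V (1.3)] -/
theorem exists_mobius_datum [CompleteSpace K] [Finite 𝓀[K]] (hD : IsRamifiedQuadraticDatum σ ϖ d t) (h2v : Valued.v (2 : K) < 1)
    {c : K} (hσc : σ c = c) (hvc : Valued.v c = 1) {s : ℕ} (hs : 2 * (d - 1) ≤ s)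
    (R : Finset K) (hR₁ : ∀ r ∈ R, Valued.v r ≤ 1) (hR₂ : ∀ x : K, Valued.v x ≤ 1 → ∃ r ∈ R, Valued.v (x - r) ≤ Valued.v ϖ ^ s)
    (hR₃ : ∀ r ∈ R, ∀ r' ∈ R, Valued.v (r - r') ≤ Valued.v ϖ ^ s → r = r') (hRu : ∃ r ∈ R, Valued.v r = 1) :
    ∃ a b : K, Valued.v a = 1 ∧ Valued.v b ≤ Valued.v ϖ ∧ ¬ ∃ z : K, z * σ z = a * σ a - c * (b * σ b) := by
  classical
  obtain ⟨hσ, hvσ, hϖ, hfix, hd, hd1, -⟩ := id hD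
  have h2d : 2 ≤ d := two_le_of_v_two_lt_one hσ hvσ hfix hϖ hd hD.2.2.2.2.2.2 h2v
  -- it suffices to find a unit residue `r` with `ω(1 + (−c)·ϖ_F·N r) = −1`
  suffices hex : ∃ r ∈ R, Valued.v r = 1 ∧ normSign σ (1 + -c * (ϖ * σ ϖ) ^ 1 * (r * σ r)) = -1 by
    obtain ⟨r, -, hr1, hω⟩ := hex
    refine ⟨1, ϖ * r, by rw [map_one], by rw [map_mul, hr1, mul_one], fun hz => ?_⟩
    have h1 : normSign σ (1 * σ 1 - c * (ϖ * r * σ (ϖ * r))) = 1 := normSign_of_isNorm σ hz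
    rw [show (1 : K) * σ 1 - c * (ϖ * r * σ (ϖ * r)) = 1 + -c * (ϖ * σ ϖ) ^ 1 * (r * σ r) by rw [map_one, map_mul]; ring] at h1
    rw [h1] at hω
    norm_num at hω
  have hσc' : σ (-c) = -c := by rw [map_neg, hσc]
  have hvc' : Valued.v (-c) = 1 := by rw [Valuation.map_neg, hvc]
  -- the unit part of `R` is non-empty
  have hcard : 0 < (R.filter fun r => Valued.v r = 1).card := by
    obtain ⟨r, hr, hr1⟩ := hRu
    exact Finset.card_pos.2 ⟨r, Finset.mem_filter.2 ⟨hr, hr1⟩⟩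
  -- if every unit residue had `ω = +1`, the signed sum would be `#R^×`
  by_contra hnone
  push Not at hnone
  have hall : ∀ r ∈ R.filter (fun r => Valued.v r = 1), normSign σ (1 + -c * (ϖ * σ ϖ) ^ 1 * (r * σ r)) = 1 := by
    intro r hr
    rw [Finset.mem_filter] at hr
    by_cases hz : ∃ z : K, z * σ z = 1 + -c * (ϖ * σ ϖ) ^ 1 * (r * σ r)
    · exact normSign_of_isNorm σ hz
    · exact absurd (normSign_of_not_isNorm σ hz) (hnone r hr.1 hr.2)
  have hsum : ∑ r ∈ R with Valued.v r = 1, normSign σ (1 + -c * (ϖ * σ ϖ) ^ 1 * (r * σ r)) = ((R.filter fun r => Valued.v r = 1).card : ℤ) := by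
    rw [Finset.sum_congr rfl hall, Finset.sum_const, nsmul_eq_mul, mul_one]
  rcases Nat.lt_or_ge 2 d with h3 | h2'
  · -- `d ≥ 3`: regime (B) at `j = 1`, over a system of fixed unit representatives mod `|ϖ|^{2(d−1)}`
    obtain ⟨Aset, hAfin, -, hA1, hA2, hA3⟩ := exists_fixed_class_representatives hσ hvσ hfix hϖ hd (2 * (d - 1)) 0 (by omega)
    set A := hAfin.toFinset with hAdef
    have hzero := sum_units_normSign_binaryNormForm_eq_zero hD h2v (C₀ := 1) (C₁ := -c) (map_one σ) (map_one _) hσc' hvc' (j := 1) le_rfl (by omega) (by omega)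
      R hR₁ hR₂ hR₃ A (fun a ha => by have := hA1 a (hAfin.mem_toFinset.1 ha); simpa using this)
      (fun u hσu hu1 => by
        obtain ⟨g, hg, hug⟩ := hA2 u hσu (by simpa using hu1)
        exact ⟨g, hAfin.mem_toFinset.2 hg, by simpa using hug⟩)
      (fun a ha a' ha' h => hA3 a (hAfin.mem_toFinset.1 ha) a' (hAfin.mem_toFinset.1 ha') (by simpa using h))
    rw [hsum] at hzero
    exact absurd hzero (by exact_mod_cast hcard.ne')
  · -- `d = 2`: regime (C) at `j = d − 1 = 1`, over a system of fixed integral representatives mod `|ϖ|²`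
    have hd2 : d = 2 := le_antisymm h2' h2d
    obtain ⟨A₀, hA1, hA2, hA3, -⟩ := exists_repr_fixedBall_card hσ hvσ hfix hϖ hd 2 0
    have hC := card_mul_sum_units_normSign_binaryNormForm_conductor hD h2v (C₀ := 1) (C₁ := -c) (map_one σ) (map_one _) hσc' hvc' h2d (s := s) (by omega)
      R hR₁ hR₂ hR₃ A₀ (fun a ha => by have := hA1 a ha; simpa using this)
      (fun u hσu hu1 => by obtain ⟨g, hg, hug⟩ := hA2 u hσu (by simpa using hu1); exact ⟨g, hg, by simpa using hug⟩)
      (fun a ha a' ha' h => hA3 a ha a' ha' (by simpa using h))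
    rw [hd2, show (2 : ℕ) - 1 = 1 from rfl, hsum, normSign_one] at hC
    -- `#A₀^× · #R^× = −#R^×` is absurd
    have hpos : (0 : ℤ) < ((R.filter fun r => Valued.v r = 1).card : ℤ) := by exact_mod_cast hcard
    have hnn : (0 : ℤ) ≤ ((A₀.filter fun a => Valued.v a = 1).card : ℤ) * ((R.filter fun r => Valued.v r = 1).card : ℤ) :=
      mul_nonneg (by exact_mod_cast Nat.zero_le _) hpos.le
    rw [hC] at hnn
    linarith

/-! ## §2  The anisotropic conic count, datum-free -/

/-- **(D-aniso) UNCONDITIONAL.**  Ramified datum on a complete `K` with finite residue field, `|2| < 1`; `C₀, C₁` fixed units with `−C₀∕C₁` NOT a norm; `R` a complete irredundant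
residue system modulo `ϖ^s`, `4d ≤ s + 3`.  Then **`Σ_{r ∈ R, |r| = 1} ω(C₀ + C₁·N r) = 0`** — ★ FILE 4 fed with §1's datum (if `R` has no unit class the sum is empty).
[cite: Serre1979, Ch. V §3 Cor. 3; Ch. XIII §5; Ch. XV §2] -/
theorem sum_units_normSign_binaryNormForm_zero_eq_zero_of_anisotropic' [CompleteSpace K] [Finite 𝓀[K]] (hD : IsRamifiedQuadraticDatum σ ϖ d t)
    (h2v : Valued.v (2 : K) < 1)
    {C₀ C₁ : K} (hσC₀ : σ C₀ = C₀) (hC₀ : Valued.v C₀ = 1) (hσC₁ : σ C₁ = C₁) (hC₁ : Valued.v C₁ = 1)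
    (hani : ¬ ∃ z : K, z * σ z = -(C₀ / C₁)) {s : ℕ} (hs : 4 * d ≤ s + 3)
    (R : Finset K) (hR₁ : ∀ r ∈ R, Valued.v r ≤ 1) (hR₂ : ∀ x : K, Valued.v x ≤ 1 → ∃ r ∈ R, Valued.v (x - r) ≤ Valued.v ϖ ^ s)
    (hR₃ : ∀ r ∈ R, ∀ r' ∈ R, Valued.v (r - r') ≤ Valued.v ϖ ^ s → r = r') :
    ∑ r ∈ R with Valued.v r = 1, normSign σ (C₀ + C₁ * (r * σ r)) = 0 := by
  classical
  by_cases hRu : ∃ r ∈ R, Valued.v r = 1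
  · have hσc : σ (-(C₀ / C₁)) = -(C₀ / C₁) := by rw [map_neg, map_div₀, hσC₀, hσC₁]
    have hvc : Valued.v (-(C₀ / C₁)) = 1 := by rw [Valuation.map_neg, map_div₀, hC₀, hC₁, div_one]
    obtain ⟨a, b, ha, hb, hnrd⟩ := exists_mobius_datum hD h2v hσc hvc (s := s) (by omega) R hR₁ hR₂ hR₃ hRu
    exact sum_units_normSign_binaryNormForm_zero_eq_zero_of_anisotropic hD hσC₀ hC₀ hσC₁ hC₁ hani ha hb hnrd hs R hR₁ hR₂ hR₃
  · push Not at hRu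
    rw [Finset.filter_eq_empty_iff.2 (fun r hr h => hRu r hr h), Finset.sum_empty]

end Summit.HodgeConjecture.HodgeConjecture.Cruxes.H413.F0P3cDyRamBinaryNormFormConicOfRecord

end
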